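import Literature.RingTheory.MvPolynomial.MultigradedBezoutCount
import Literature.Computability.AlgebraicComplexity.DeterminantalConormalBoundKernelAlgebra
import Literature.Computability.AlgebraicComplexity.DeterminantalConormalBoundClass
import HarnessLib

/-!
# Sheshadri's polar-count bound `#(polar set) ≤ B(m, N)` via the multigraded refined Bézout count

Topic: `Literature/Computability/AlgebraicComplexity`. This file discharges the named fact
`Sheshadri2026_polarCount_le` (arXiv:2606.13628, Lemmas 4–5, eq. (1.1)):
for a form `f = det A` with an affine `m × m` determinantal representation in `N ≥ 3` variables,
generic covectors `a, b, c` have `#T_f(a, b, c) ≤ B(m, N) = Σ_i C(m,i) C(m-1,N-1-i) C(N-2,i-1)`.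

## The argument (§3.1 of the paper, made unconditional in the count)

* Step 2–4 (kernel-incidence system).  On the variables `(x₀ : x) ∈ ℙ^N`, `[u] ∈ ℙ^{m-1}`,
  `[v] ∈ ℙ^{m-1}` consider the multihomogeneous system of `N + 2m - 2` equations:
  the chart `x₀ = Σ cᵢ xᵢ` (multidegree `e₀`), the `m` right kernel equations `Â(x) v = 0`
  (`e₀ + e_V`), `m - 1` generic combinations `(uᵀ Â(x)) Λ = 0` of the left kernel equations
  (`e₀ + e_U`), and the `N - 2` independent conditions "`w(u,v) = (uᵀ Aᵢ v)_i ∈ span(a, b)`"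
  (`e_U + e_V`), where `Â` is the homogenised pencil and `Aᵢ` its coefficient matrices.
* Every polar point `x ∈ T_f(a,b,c)` lifts to a solution `(1 : x, [u_x], [v_x])` (kernel pair of
  the corank-one matrix `A(x)`, Jacobi's formula `∂ᵢ f = uᵀ Aᵢ v`), distinct points giving
  distinct torus orbits, and each such solution is isolated among all solutions in the strong
  sense required by `card_le_mixedBezout_of_isolated_fintype`: off an explicit hypersurface
  (`x₀ ≠ 0`, a non-zero `(m-1)`-minor, the reduction condition `det (Λᵀ B'_v) ≠ 0`, and
  `w ≠ 0`) every solution comes from a polar point (`mem_polarSet_of_kernelSystem`).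
* The refined Bézout count in `ℙ^N × ℙ^{m-1} × ℙ^{m-1}` (proved in
  `Literature/RingTheory/MvPolynomial/MultigradedBezoutCount.lean` by van der Waerden's
  multigraded Hilbert-function method) bounds
  the number of such isolated orbits by the mixed Bézout number
  `[T₀^N T_V^{m-1} T_U^{m-1}] T₀ (T₀+T_V)^m (T₀+T_U)^{m-1} (T_U+T_V)^{N-2} = B(m, N)`
  (`coeff_generatingFunction_eq_conormalBezout`), with no transversality or dimension hypothesis.
* Genericity: `Φ(a,b,c) ≠ 0` only has to guarantee `a ∦ b` and that the `N - 2` pencil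
  equations are non-zero polynomials; infinite polar sets have `ncard = 0`.  The small cases
  `N = 3`, `deg f ≤ 2`, `m ≤ 2` are `Sheshadri2026_polarCount_le_of_small_cases`.

[cite: Sheshadri2026Border, §3.1, Lemmas 4–5]; [cite: Fulton1998, Example 12.3.1].
-/

noncomputable section

open MvPolynomial Matrix Finset

namespace Literature.Computability.AlgebraicComplexity

namespace DeterminantalConormal

open Literature.RingTheory.MvPolynomial

/-! ## One solution of the kernel system comes from a polar point -/

/-- **Solutions of the kernel-incidence system off the bad hypersurface are polar lifts**
(arXiv:2606.13628 §3.1 Steps 2–4, pointwise): let `A` have affine-linear entries, `a ∦ b`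
(`a_{j₀} b_{k₀} − a_{k₀} b_{j₀} ≠ 0`), and let `(x, u, v)` satisfy the chart equation
`Σ cᵢ xᵢ = 1`, `A(x) v = 0`, the reduced left equations `(uᵀ A(x)) Λ = 0` and the pencil
equations expressing `w = (uᵀ Aᵢ v)_i ∈ span(a, b)`; assume `v_{l₂} ≠ 0`, the reduction
condition `det (Λᵀ B'_v) ≠ 0`, `adj A(x) ≠ 0` and `w ≠ 0`. Then `x` is a polar point,
`uᵀ A(x) = 0`, `u ≠ 0` and `v ≠ 0`. [cite: Sheshadri2026Border, §3.1 Steps 2–4] -/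
theorem mem_polarSet_of_kernelSystem {σ : Type*} [Fintype σ] {m : ℕ}
    (A : Matrix (Fin (m + 1)) (Fin (m + 1)) (MvPolynomial σ ℂ))
    (hA1 : ∀ k l, (A k l).totalDegree ≤ 1) (a b c : σ → ℂ) {j₀ k₀ : σ}
    (hδ : a j₀ * b k₀ - a k₀ * b j₀ ≠ 0) (Λ : Matrix (Fin (m + 1)) (Fin m) ℂ)
    (x : σ → ℂ) (u v : Fin (m + 1) → ℂ) (hchart : ∑ i, c i * x i = 1)
    (hrows : A.map (eval x) *ᵥ v = 0) (hucut : (u ᵥ* A.map (eval x)) ᵥ* Λ = 0)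
    (hpencil : ∀ i, i ≠ j₀ → i ≠ k₀ →
      (a j₀ * b k₀ - a k₀ * b j₀) *
          (u ⬝ᵥ (A.map (fun p => coeff (Finsupp.single i 1) p) *ᵥ v)) -
        (b k₀ * (u ⬝ᵥ (A.map (fun p => coeff (Finsupp.single j₀ 1) p) *ᵥ v)) -
          b j₀ * (u ⬝ᵥ (A.map (fun p => coeff (Finsupp.single k₀ 1) p) *ᵥ v))) * a i -
        (a j₀ * (u ⬝ᵥ (A.map (fun p => coeff (Finsupp.single k₀ 1) p) *ᵥ v)) -
          a k₀ * (u ⬝ᵥ (A.map (fun p => coeff (Finsupp.single j₀ 1) p) *ᵥ v))) * b i = 0)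
    {l₂ : Fin (m + 1)} (hvl₂ : v l₂ ≠ 0)
    (hdetΛ : (Λᵀ * Matrix.of (fun i j => if i = l₂.succAbove j then v l₂
      else if i = l₂ then -(v (l₂.succAbove j)) else 0)).det ≠ 0)
    (hadj : (A.map (eval x)).adjugate ≠ 0)
    (hW : ∃ i, u ⬝ᵥ (A.map (fun p => coeff (Finsupp.single i 1) p) *ᵥ v) ≠ 0) :
    x ∈ polarSet A.det a b c ∧ u ᵥ* A.map (eval x) = 0 ∧ u ≠ 0 ∧ v ≠ 0 := by
  classical
  set M := A.map (eval x) with hM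
  set w : σ → ℂ := fun i => u ⬝ᵥ (A.map (fun p => coeff (Finsupp.single i 1) p) *ᵥ v) with hw
  obtain ⟨i₁, hi₁⟩ := hW
  have hu0 : u ≠ 0 := by
    rintro rfl; exact hi₁ (by rw [zero_dotProduct])
  have hv0 : v ≠ 0 := by
    rintro rfl; exact hi₁ (by rw [mulVec_zero, dotProduct_zero])
  have hdet : M.det = 0 := Matrix.exists_mulVec_eq_zero_iff.mp ⟨v, hv0, hrows⟩
  -- the left equations
  have huM : u ᵥ* M = 0 := vecMul_eq_zero_of_left_reduction hrows hvl₂ Λ hdetΛ u hucut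
  -- kernel pair and kernel lines
  obtain ⟨u₀, v₀, hu₀, hv₀, hu₀M, hMv₀, hadj₀⟩ := exists_kernelPair_of_adjugate_ne_zero hdet hadj
  obtain ⟨α, hα⟩ := exists_smul_of_vecMul_eq_zero hdet hadj hu₀ hu₀M u huM
  obtain ⟨β, hβ⟩ := exists_smul_of_mulVec_eq_zero hdet hadj hv₀ hMv₀ v hrows
  have hα0 : α ≠ 0 := by rintro rfl; exact hu0 (by rw [hα, zero_smul])
  have hβ0 : β ≠ 0 := by rintro rfl; exact hv0 (by rw [hβ, zero_smul])
  -- Jacobi: `∂ᵢ f(x) = u₀ᵀ Aᵢ v₀ = (αβ)⁻¹ wᵢ`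
  have hAi : ∀ i, A.map (fun p => eval x (pderiv i p)) =
      A.map (fun p => coeff (Finsupp.single i 1) p) := by
    intro i; ext k l
    exact eval_pderiv_eq_coeff_of_totalDegree_le_one (hA1 k l) i x
  have hpd : ∀ i, eval x (pderiv i A.det) = (α * β)⁻¹ * w i := by
    intro i
    rw [eval_pderiv_det, ← hM, hadj₀, vecMulVec_mul, Matrix.trace_vecMulVec, dotProduct_comm,
      ← Matrix.dotProduct_mulVec, hAi i, hw]
    simp only
    rw [hα, hβ, mulVec_smul, dotProduct_smul, smul_dotProduct, smul_eq_mul, smul_eq_mul]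
    field_simp
  -- the pencil equations for all `i` (the two omitted ones hold identically)
  have hpencil' : ∀ i, (a j₀ * b k₀ - a k₀ * b j₀) * w i - (b k₀ * w j₀ - b j₀ * w k₀) * a i -
      (a j₀ * w k₀ - a k₀ * w j₀) * b i = 0 := by
    intro i
    by_cases hij : i = j₀
    · subst hij; ring
    by_cases hik : i = k₀
    · subst hik; ring
    exact hpencil i hij hik
  obtain ⟨s, t, hst⟩ := (polarSystem_eq_zero_iff hδ).mp hpencil'
  refine ⟨⟨?_, ⟨i₁, ?_⟩, ⟨(α * β)⁻¹ * s, (α * β)⁻¹ * t, fun i => ?_⟩, hchart⟩, huM, hu0, hv0⟩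
  · rw [← det_map_eval]; exact hdet
  · rw [hpd]
    exact mul_ne_zero (inv_ne_zero (mul_ne_zero hα0 hβ0)) hi₁
  · rw [hpd, hst i]; ring


/-! ## The count for one pencil -/

/-- **The polar count for a fixed generic pencil** (arXiv:2606.13628, §3.1 and Lemma 5, made
unconditional by the refined Bézout count): for `f = det A` with affine-linear entries,
`det A ≠ 0`, covectors with `a_{j₀} b_{k₀} − a_{k₀} b_{j₀} ≠ 0` and all `N − 2` pencil
equations non-trivial, a FINITE polar set has at most `B(m, N)` points.
[cite: Sheshadri2026Border, Lemma 5, eq. (1.1)] -/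
theorem ncard_polarSet_le_conormalBezout_of_pencil {σ : Type} [Fintype σ] [DecidableEq σ]
    {m : ℕ} (hσ : 3 ≤ Fintype.card σ)
    (A : Matrix (Fin (m + 1)) (Fin (m + 1)) (MvPolynomial σ ℂ))
    (hA1 : ∀ k l, (A k l).totalDegree ≤ 1) (hA0 : A.det ≠ 0) (a b c : σ → ℂ) {j₀ k₀ : σ}
    (hjk : j₀ ≠ k₀) (hδ : a j₀ * b k₀ - a k₀ * b j₀ ≠ 0)
    (hM : ∀ i, i ≠ j₀ → i ≠ k₀ → ∃ k l,
      (a j₀ * b k₀ - a k₀ * b j₀) * coeff (Finsupp.single i 1) (A k l) -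
        (b k₀ * coeff (Finsupp.single j₀ 1) (A k l) - b j₀ * coeff (Finsupp.single k₀ 1) (A k l)) *
          a i -
        (a j₀ * coeff (Finsupp.single k₀ 1) (A k l) - a k₀ * coeff (Finsupp.single j₀ 1) (A k l)) *
          b i ≠ 0)
    (hfin : (polarSet A.det a b c).Finite) :
    (polarSet A.det a b c).ncard ≤ conormalBezout (m + 1) (Fintype.card σ) := by
  classical
  haveI : Nonempty σ := ⟨j₀⟩
  -- ### notation: variables `τ = (x₀ ⊔ σ) ⊔ (u ⊔ v)`, blocks `x ↦ 0`, `u ↦ 2`, `v ↦ 1`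
  set x0 : (Unit ⊕ σ) ⊕ (Fin (m + 1) ⊕ Fin (m + 1)) := Sum.inl (Sum.inl ()) with hx0
  set xv : σ → (Unit ⊕ σ) ⊕ (Fin (m + 1) ⊕ Fin (m + 1)) := fun i => Sum.inl (Sum.inr i) with hxv
  set uu : Fin (m + 1) → (Unit ⊕ σ) ⊕ (Fin (m + 1) ⊕ Fin (m + 1)) := fun k => Sum.inr (Sum.inl k)
    with huu
  set vv : Fin (m + 1) → (Unit ⊕ σ) ⊕ (Fin (m + 1) ⊕ Fin (m + 1)) := fun l => Sum.inr (Sum.inr l)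
    with hvv
  set blk : (Unit ⊕ σ) ⊕ (Fin (m + 1) ⊕ Fin (m + 1)) → Fin 3 :=
    Sum.elim (fun _ => 0) (Sum.elim (fun _ => 2) (fun _ => 1)) with hblk
  -- ### the homogenised pencil
  set phat : MvPolynomial σ ℂ → MvPolynomial ((Unit ⊕ σ) ⊕ (Fin (m + 1) ⊕ Fin (m + 1))) ℂ :=
    fun p => C (coeff 0 p) * X x0 + ∑ i, C (coeff (Finsupp.single i 1) p) * X (xv i) with hphat
  set Ahat := A.map phat with hAhat
  have hphat_eval : ∀ p (y : (Unit ⊕ σ) ⊕ (Fin (m + 1) ⊕ Fin (m + 1)) → ℂ),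
      eval y (phat p) = y x0 * coeff 0 p + ∑ i, y (xv i) * coeff (Finsupp.single i 1) p := by
    intro p y
    simp only [hphat, map_add, map_sum, map_mul, eval_C, eval_X]
    rw [mul_comm]
    exact congrArg _ (Finset.sum_congr rfl fun i _ => mul_comm _ _)
  have hphat_scale : ∀ p, p.totalDegree ≤ 1 →
      ∀ (y : (Unit ⊕ σ) ⊕ (Fin (m + 1) ⊕ Fin (m + 1)) → ℂ) (x' : σ → ℂ),
        (∀ i, y (xv i) = y x0 * x' i) → eval y (phat p) = y x0 * eval x' p := by
    intro p hp y x' h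
    rw [hphat_eval, eval_eq_coeff_zero_add_sum hp, mul_add, Finset.mul_sum]
    refine congrArg _ (Finset.sum_congr rfl fun i _ => ?_)
    rw [h i]; ring
  have hAhat_scale : ∀ (y : (Unit ⊕ σ) ⊕ (Fin (m + 1) ⊕ Fin (m + 1)) → ℂ) (x' : σ → ℂ),
      (∀ i, y (xv i) = y x0 * x' i) → Ahat.map (eval y) = y x0 • A.map (eval x') := by
    intro y x' h
    ext k l
    simp only [hAhat, Matrix.map_apply, Matrix.smul_apply, smul_eq_mul]
    exact hphat_scale _ (hA1 k l) y x' h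
  have hphat_ne : ∀ p, p.totalDegree ≤ 1 → p ≠ 0 → phat p ≠ 0 := by
    intro p hp hp0 h0
    apply hp0
    rw [eq_zero_iff_of_totalDegree_le_one hp]
    constructor
    · have h1 := congrArg (eval (fun t => if t = x0 then (1 : ℂ) else 0)) h0
      rw [hphat_eval, map_zero] at h1
      simpa [hxv, hx0] using h1
    · intro i
      have h1 := congrArg (eval (fun t => if t = xv i then (1 : ℂ) else 0)) h0
      rw [hphat_eval, map_zero] at h1
      simp only [hxv, hx0, reduceCtorEq, Sum.inl.injEq, if_false, zero_mul, zero_add,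
        Sum.inr.injEq] at h1
      rw [Finset.sum_eq_single i (fun j _ hj => by rw [if_neg hj, zero_mul])
        (fun h => absurd (Finset.mem_univ i) h), if_pos rfl, one_mul] at h1
      exact h1
  -- `A ≠ 0`, rows of `A` are non-zero, `Â ≠ 0`
  have hrowA : ∀ k, ∃ l, A k l ≠ 0 := by
    intro k
    by_contra h
    push Not at h
    exact hA0 (Matrix.det_eq_zero_of_row_eq_zero k h)
  have hAhat0 : Ahat ≠ 0 := by
    obtain ⟨l, hl⟩ := hrowA 0
    intro h
    have := congrFun (congrFun h 0) l
    rw [hAhat, Matrix.map_apply, Matrix.zero_apply] at this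
    exact hphat_ne _ (hA1 0 l) hl this
  -- ### the polar points and their kernel data
  set P := hfin.toFinset with hP
  have hPmem : ∀ x, x ∈ P ↔ x ∈ polarSet A.det a b c := fun x => Set.Finite.mem_toFinset hfin
  have hAi : ∀ (x : σ → ℂ) i, A.map (fun p => eval x (pderiv i p)) =
      A.map (fun p => coeff (Finsupp.single i 1) p) := by
    intro x i; ext k l
    exact eval_pderiv_eq_coeff_of_totalDegree_le_one (hA1 k l) i x
  have hkp : ∀ x ∈ P, ∃ u v : Fin (m + 1) → ℂ, u ≠ 0 ∧ v ≠ 0 ∧ u ᵥ* A.map (eval x) = 0 ∧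
      A.map (eval x) *ᵥ v = 0 ∧ (A.map (eval x)).adjugate = vecMulVec v u ∧
      ∀ i, eval x (pderiv i A.det) =
        u ⬝ᵥ (A.map (fun p => coeff (Finsupp.single i 1) p) *ᵥ v) := by
    intro x hx
    obtain ⟨hfx, hdf, -, -⟩ := (hPmem x).mp hx
    obtain ⟨u, v, hu, hv, huM, hMv, hadj, hpd⟩ :=
      exists_kernelPair_of_eval_pderiv_ne_zero A hfx hdf
    exact ⟨u, v, hu, hv, huM, hMv, hadj, fun i => by rw [hpd i, hAi]⟩
  choose! ux vx hux hvx huxM hMvx hadjx hpdx using hkp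
  have hl₂' : ∀ x ∈ P, ∃ l, vx x l ≠ 0 := fun x hx => Function.ne_iff.mp (hvx x hx)
  choose! l₂ hl₂ using hl₂'
  have hi₁' : ∀ x ∈ P, ∃ i, eval x (pderiv i A.det) ≠ 0 := fun x hx => ((hPmem x).mp hx).2.1
  choose! i₁ hi₁ using hi₁'
  have hkl' : ∀ x ∈ P, ∃ k l, (A.map (eval x)).adjugate k l ≠ 0 := by
    intro x hx
    have h : (A.map (eval x)).adjugate ≠ 0 := by
      rw [hadjx x hx]
      intro h0
      rcases vecMulVec_eq_zero.mp h0 with h1 | h1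
      · exact hvx x hx h1
      · exact hux x hx h1
    obtain ⟨k, hk⟩ := Function.ne_iff.mp h
    obtain ⟨l, hl⟩ := Function.ne_iff.mp hk
    exact ⟨k, l, hl⟩
  choose! k₁ l₁ hkl using hkl'
  -- ### the reduction matrix
  obtain ⟨Λ, hΛdet, hΛcol⟩ := exists_left_reduction_matrix P vx l₂ hl₂ Ahat hAhat0
  -- ### the system
  set wp : σ → MvPolynomial ((Unit ⊕ σ) ⊕ (Fin (m + 1) ⊕ Fin (m + 1))) ℂ := fun i =>
    ∑ k, ∑ l, C (coeff (Finsupp.single i 1) (A k l)) * X (uu k) * X (vv l) with hwp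
  set Q : (Unit ⊕ Fin (m + 1)) ⊕ (Fin m ⊕ {i : σ // i ≠ j₀ ∧ i ≠ k₀}) →
      MvPolynomial ((Unit ⊕ σ) ⊕ (Fin (m + 1) ⊕ Fin (m + 1))) ℂ :=
    Sum.elim
      (Sum.elim (fun _ => X x0 - ∑ i, C (c i) * X (xv i)) (fun k => ∑ l, Ahat k l * X (vv l)))
      (Sum.elim
        (fun j => ∑ k, X (uu k) * (Ahat * Λ.map (fun r : ℂ =>
          (C r : MvPolynomial ((Unit ⊕ σ) ⊕ (Fin (m + 1) ⊕ Fin (m + 1))) ℂ))) k j)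
        (fun i => C (a j₀ * b k₀ - a k₀ * b j₀) * wp i.1 -
          (C (b k₀) * wp j₀ - C (b j₀) * wp k₀) * C (a i.1) -
          (C (a j₀) * wp k₀ - C (a k₀) * wp j₀) * C (b i.1))) with hQ
  set δ : (Unit ⊕ Fin (m + 1)) ⊕ (Fin m ⊕ {i : σ // i ≠ j₀ ∧ i ≠ k₀}) → Fin 3 → ℕ :=
    Sum.elim (Sum.elim (fun _ => Pi.single 0 1) (fun _ => Pi.single 0 1 + Pi.single 1 1))
      (Sum.elim (fun _ => Pi.single 0 1 + Pi.single 2 1) (fun _ => Pi.single 1 1 + Pi.single 2 1))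
    with hδdef
  set z : (σ → ℂ) → (Unit ⊕ σ) ⊕ (Fin (m + 1) ⊕ Fin (m + 1)) → ℂ := fun x =>
    Sum.elim (Sum.elim (fun _ => 1) x) (Sum.elim (ux x) (vx x)) with hz
  set T := P.image z with hT
  -- ### evaluation of the system
  have heval_w : ∀ (y : (Unit ⊕ σ) ⊕ (Fin (m + 1) ⊕ Fin (m + 1)) → ℂ) i, eval y (wp i) =
      (fun k => y (uu k)) ⬝ᵥ (A.map (fun p => coeff (Finsupp.single i 1) p) *ᵥ fun l => y (vv l)) := by
    intro y i
    simp only [hwp, map_sum, map_mul, eval_C, eval_X, dotProduct, mulVec, Matrix.map_apply,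
      Finset.mul_sum]
    refine Finset.sum_congr rfl fun k _ => Finset.sum_congr rfl fun l _ => ?_
    ring
  have heval_chart : ∀ y : (Unit ⊕ σ) ⊕ (Fin (m + 1) ⊕ Fin (m + 1)) → ℂ,
      eval y (Q (Sum.inl (Sum.inl ()))) = y x0 - ∑ i, c i * y (xv i) := by
    intro y
    simp [hQ]
  have heval_row : ∀ (y : (Unit ⊕ σ) ⊕ (Fin (m + 1) ⊕ Fin (m + 1)) → ℂ) k,
      eval y (Q (Sum.inl (Sum.inr k))) = (Ahat.map (eval y) *ᵥ fun l => y (vv l)) k := by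
    intro y k
    simp [hQ, mulVec, dotProduct]
  have heval_ucut : ∀ (y : (Unit ⊕ σ) ⊕ (Fin (m + 1) ⊕ Fin (m + 1)) → ℂ) j,
      eval y (Q (Sum.inr (Sum.inl j))) = (((fun k => y (uu k)) ᵥ* Ahat.map (eval y)) ᵥ* Λ) j := by
    intro y j
    simp only [hQ, Sum.elim_inr, Sum.elim_inl, map_sum, map_mul, eval_X, Matrix.mul_apply,
      Matrix.map_apply, eval_C, vecMul, dotProduct, Finset.sum_mul]
    rw [Finset.sum_comm]
    refine Finset.sum_congr rfl fun k _ => ?_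
    rw [Finset.mul_sum]
    refine Finset.sum_congr rfl fun l _ => ?_
    ring
  have heval_pencil : ∀ (y : (Unit ⊕ σ) ⊕ (Fin (m + 1) ⊕ Fin (m + 1)) → ℂ)
      (i : {i : σ // i ≠ j₀ ∧ i ≠ k₀}), eval y (Q (Sum.inr (Sum.inr i))) =
      (a j₀ * b k₀ - a k₀ * b j₀) * eval y (wp i.1) -
        (b k₀ * eval y (wp j₀) - b j₀ * eval y (wp k₀)) * a i.1 -
        (a j₀ * eval y (wp k₀) - a k₀ * eval y (wp j₀)) * b i.1 := by
    intro y i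
    simp [hQ]
  -- ### values at the lifted polar points
  have hzx0 : ∀ x, z x x0 = 1 := fun x => by simp [hz, hx0]
  have hzxv : ∀ x i, z x (xv i) = x i := fun x i => by simp [hz, hxv]
  have hzuu : ∀ x k, z x (uu k) = ux x k := fun x k => by simp [hz, huu]
  have hzvv : ∀ x l, z x (vv l) = vx x l := fun x l => by simp [hz, hvv]
  have hAhat_z : ∀ x, Ahat.map (eval (z x)) = A.map (eval x) := by
    intro x
    rw [hAhat_scale (z x) x (fun i => by rw [hzxv, hzx0, one_mul]), hzx0, one_smul]
  have hw_z : ∀ x ∈ P, ∀ i, eval (z x) (wp i) = eval x (pderiv i A.det) := by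
    intro x hx i
    rw [heval_w, hpdx x hx i]
    simp only [hzuu, hzvv]
  have hzinj : Function.Injective z := by
    intro x x₂ h
    funext i
    rw [← hzxv x i, ← hzxv x₂ i, h]
  -- ### hypotheses of the refined Bézout count
  have hblk' : ∀ l : Fin 3, ∃ t, blk t = l := by
    intro l
    fin_cases l
    exacts [⟨x0, by simp [hblk, hx0]⟩, ⟨vv 0, by simp [hblk, hvv]⟩, ⟨uu 0, by simp [hblk, huu]⟩]
  have hcardS : Fintype.card {i : σ // i ≠ j₀ ∧ i ≠ k₀} = Fintype.card σ - 2 := by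
    rw [Fintype.card_subtype]
    have hset : (univ.filter fun i : σ => i ≠ j₀ ∧ i ≠ k₀) = (univ.erase j₀).erase k₀ := by
      ext i
      simp only [Finset.mem_filter, Finset.mem_univ, true_and, Finset.mem_erase, and_true]
      tauto
    rw [hset, Finset.card_erase_of_mem (Finset.mem_erase.mpr ⟨hjk.symm, Finset.mem_univ _⟩),
      Finset.card_erase_of_mem (Finset.mem_univ _), Finset.card_univ]
    omega
  have hr' : Fintype.card ((Unit ⊕ Fin (m + 1)) ⊕ (Fin m ⊕ {i : σ // i ≠ j₀ ∧ i ≠ k₀})) +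
      Fintype.card (Fin 3) = Fintype.card ((Unit ⊕ σ) ⊕ (Fin (m + 1) ⊕ Fin (m + 1))) := by
    simp only [Fintype.card_sum, Fintype.card_fin, Fintype.card_unit, hcardS]
    omega
  -- multihomogeneity
  have hQ' : ∀ j, (Q j).IsWeightedHomogeneous
      (fun t => (Pi.single (blk t) 1 : Fin 3 → ℕ)) (δ j) := by
    set wt : (Unit ⊕ σ) ⊕ (Fin (m + 1) ⊕ Fin (m + 1)) → Fin 3 → ℕ :=
      fun t => Pi.single (blk t) 1 with hwt
    have hX0 : IsWeightedHomogeneous wt (X x0 : MvPolynomial ((Unit ⊕ σ) ⊕ (Fin (m + 1) ⊕ Fin (m + 1))) ℂ) (Pi.single 0 1) := by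
      simpa [hwt, hblk, hx0] using isWeightedHomogeneous_X (R := ℂ) wt x0
    have hXv : ∀ i, IsWeightedHomogeneous wt (X (xv i) : MvPolynomial ((Unit ⊕ σ) ⊕ (Fin (m + 1) ⊕ Fin (m + 1))) ℂ) (Pi.single 0 1) :=
        fun i => by
      simpa [hwt, hblk, hxv] using isWeightedHomogeneous_X (R := ℂ) wt (xv i)
    have hXu : ∀ k, IsWeightedHomogeneous wt (X (uu k) : MvPolynomial ((Unit ⊕ σ) ⊕ (Fin (m + 1) ⊕ Fin (m + 1))) ℂ) (Pi.single 2 1) :=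
        fun k => by
      simpa [hwt, hblk, huu] using isWeightedHomogeneous_X (R := ℂ) wt (uu k)
    have hXvv : ∀ l, IsWeightedHomogeneous wt (X (vv l) : MvPolynomial ((Unit ⊕ σ) ⊕ (Fin (m + 1) ⊕ Fin (m + 1))) ℂ) (Pi.single 1 1) :=
        fun l => by
      simpa [hwt, hblk, hvv] using isWeightedHomogeneous_X (R := ℂ) wt (vv l)
    have hCmul : ∀ (r : ℂ) {φ : MvPolynomial ((Unit ⊕ σ) ⊕ (Fin (m + 1) ⊕ Fin (m + 1))) ℂ} {n : Fin 3 → ℕ},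
        IsWeightedHomogeneous wt φ n → IsWeightedHomogeneous wt (C r * φ) n :=
      fun r φ n h => h.C_mul r
    have hmulC : ∀ (r : ℂ) {φ : MvPolynomial ((Unit ⊕ σ) ⊕ (Fin (m + 1) ⊕ Fin (m + 1))) ℂ} {n : Fin 3 → ℕ},
        IsWeightedHomogeneous wt φ n → IsWeightedHomogeneous wt (φ * C r) n :=
      fun r φ n h => by simpa using h.mul (isWeightedHomogeneous_C wt r)
    have hsub : ∀ {φ ψ : MvPolynomial ((Unit ⊕ σ) ⊕ (Fin (m + 1) ⊕ Fin (m + 1))) ℂ} {n : Fin 3 → ℕ},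
        IsWeightedHomogeneous wt φ n → IsWeightedHomogeneous wt ψ n →
          IsWeightedHomogeneous wt (φ - ψ) n :=
      fun {φ ψ n} h1 h2 => (weightedHomogeneousSubmodule ℂ wt n).sub_mem h1 h2
    have hphatw : ∀ p, IsWeightedHomogeneous wt (phat p) (Pi.single 0 1) := fun p =>
      (hCmul _ hX0).add (IsWeightedHomogeneous.sum _ _ _ fun i _ => hCmul _ (hXv i))
    have hAhatw : ∀ k l, IsWeightedHomogeneous wt (Ahat k l) (Pi.single 0 1) := fun k l => by
      rw [hAhat, Matrix.map_apply]; exact hphatw _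
    have hwpw : ∀ i, IsWeightedHomogeneous wt (wp i) (Pi.single 1 1 + Pi.single 2 1) := by
      intro i
      refine IsWeightedHomogeneous.sum _ _ _ fun k _ =>
        IsWeightedHomogeneous.sum _ _ _ fun l _ => ?_
      have h := (hCmul (coeff (Finsupp.single i 1) (A k l)) (hXu k)).mul (hXvv l)
      rwa [add_comm (Pi.single 2 1 : Fin 3 → ℕ) (Pi.single 1 1)] at h
    intro j
    rcases j with ((_ | k) | (j | i))
    · simp only [hQ, hδdef, Sum.elim_inl]
      exact hsub hX0 (IsWeightedHomogeneous.sum _ _ _ fun i _ => hCmul _ (hXv i))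
    · simp only [hQ, hδdef, Sum.elim_inl, Sum.elim_inr]
      exact IsWeightedHomogeneous.sum _ _ _ fun l _ => (hAhatw k l).mul (hXvv l)
    · simp only [hQ, hδdef, Sum.elim_inl, Sum.elim_inr]
      refine IsWeightedHomogeneous.sum _ _ _ fun k _ => ?_
      have hentry : IsWeightedHomogeneous wt ((Ahat * Λ.map fun r : ℂ =>
          (C r : MvPolynomial ((Unit ⊕ σ) ⊕ (Fin (m + 1) ⊕ Fin (m + 1))) ℂ)) k j)
          (Pi.single 0 1) := by
        rw [Matrix.mul_apply]
        exact IsWeightedHomogeneous.sum _ _ _ fun l _ => by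
          rw [Matrix.map_apply]; exact hmulC _ (hAhatw k l)
      have h := (hXu k).mul hentry
      rwa [add_comm (Pi.single 2 1 : Fin 3 → ℕ) (Pi.single 0 1)] at h
    · simp only [hQ, hδdef, Sum.elim_inr]
      exact hsub (hsub (hCmul _ (hwpw _)) (hmulC _ (hsub (hCmul _ (hwpw _)) (hCmul _ (hwpw _)))))
        (hmulC _ (hsub (hCmul _ (hwpw _)) (hCmul _ (hwpw _))))
  -- non-triviality of every equation
  have hQ0' : ∀ j, Q j ≠ 0 := by
    intro j
    rcases j with ((_ | k) | (j | i))
    · intro h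
      have h1 := congrArg (eval (fun t => if t = x0 then (1 : ℂ) else 0)) h
      rw [heval_chart, map_zero] at h1
      simp [hx0, hxv] at h1
    · obtain ⟨l, hl⟩ := hrowA k
      have hne : Ahat k l ≠ 0 := by
        rw [hAhat, Matrix.map_apply]; exact hphat_ne _ (hA1 k l) hl
      obtain ⟨ξ, hξ⟩ : ∃ ξ : (Unit ⊕ σ) ⊕ (Fin (m + 1) ⊕ Fin (m + 1)) → ℂ,
          eval ξ (Ahat k l) ≠ 0 := by
        by_contra h0
        push Not at h0
        exact hne (MvPolynomial.funext fun ξ => by rw [h0 ξ, map_zero])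
      intro h
      set y : (Unit ⊕ σ) ⊕ (Fin (m + 1) ⊕ Fin (m + 1)) → ℂ :=
        Sum.elim (fun s => ξ (Sum.inl s)) (Sum.elim (fun _ => 0) (fun l' => if l' = l then 1 else 0))
        with hy
      have h1 := congrArg (eval y) h
      rw [heval_row, map_zero] at h1
      simp only [mulVec, dotProduct, Matrix.map_apply] at h1
      rw [Finset.sum_eq_single l (fun l' _ hl' => by simp [hy, hvv, hl'])
        (fun h => absurd (Finset.mem_univ l) h)] at h1
      have hyl : y (vv l) = 1 := by simp [hy, hvv]
      rw [hyl, mul_one] at h1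
      apply hξ
      rw [← h1, hAhat, Matrix.map_apply, hphat_eval, hphat_eval]
      simp [hy, hx0, hxv]
    · obtain ⟨k, hk⟩ := hΛcol j
      obtain ⟨ξ, hξ⟩ : ∃ ξ : (Unit ⊕ σ) ⊕ (Fin (m + 1) ⊕ Fin (m + 1)) → ℂ,
          eval ξ ((Ahat * Λ.map fun r : ℂ =>
            (C r : MvPolynomial ((Unit ⊕ σ) ⊕ (Fin (m + 1) ⊕ Fin (m + 1))) ℂ)) k j) ≠ 0 := by
        by_contra h0
        push Not at h0
        exact hk (MvPolynomial.funext fun ξ => by rw [h0 ξ, map_zero])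
      intro h
      set y : (Unit ⊕ σ) ⊕ (Fin (m + 1) ⊕ Fin (m + 1)) → ℂ :=
        Sum.elim (fun s => ξ (Sum.inl s)) (Sum.elim (fun k' => if k' = k then 1 else 0) (fun _ => 0))
        with hy
      have h1 := congrArg (eval y) h
      rw [map_zero] at h1
      have h2 : eval y (Q (Sum.inr (Sum.inl j))) = ∑ k', y (uu k') * eval y ((Ahat * Λ.map fun r : ℂ =>
          (C r : MvPolynomial ((Unit ⊕ σ) ⊕ (Fin (m + 1) ⊕ Fin (m + 1))) ℂ)) k' j) := by
        simp only [hQ, Sum.elim_inr, Sum.elim_inl, map_sum, map_mul, eval_X]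
      rw [h2, Finset.sum_eq_single k (fun k' _ hk' => by simp [hy, huu, hk'])
        (fun h => absurd (Finset.mem_univ k) h)] at h1
      have hyk : y (uu k) = 1 := by simp [hy, huu]
      rw [hyk, one_mul] at h1
      apply hξ
      rw [← h1]
      simp only [Matrix.mul_apply, Matrix.map_apply, map_sum, map_mul, eval_C, hAhat, hphat_eval]
      simp [hy, hx0, hxv]
    · obtain ⟨k, l, hkl0⟩ := hM i.1 i.2.1 i.2.2
      intro h
      set y : (Unit ⊕ σ) ⊕ (Fin (m + 1) ⊕ Fin (m + 1)) → ℂ :=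
        Sum.elim (fun _ => 0) (Sum.elim (fun k' => if k' = k then 1 else 0)
          (fun l' => if l' = l then 1 else 0)) with hy
      have h1 := congrArg (eval y) h
      rw [heval_pencil, map_zero] at h1
      have hW : ∀ i', eval y (wp i') = coeff (Finsupp.single i' 1) (A k l) := by
        intro i'
        rw [heval_w]
        have e1 : (fun k' => y (uu k')) = Pi.single k 1 := by
          funext k'; simp [hy, huu, Pi.single_apply]
        have e2 : (fun l' => y (vv l')) = Pi.single l 1 := by
          funext l'; simp [hy, hvv, Pi.single_apply]
        rw [e1, e2, single_dotProduct, one_mul]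
        simp only [mulVec, dotProduct_single, mul_one, Matrix.map_apply]
      rw [hW, hW, hW] at h1
      exact hkl0 h1
  -- the targets
  have hT' : ∀ z' ∈ T, ∀ l, ∃ t, blk t = l ∧ z' t ≠ 0 := by
    intro z' hz' l
    obtain ⟨x, hx, rfl⟩ := Finset.mem_image.mp hz'
    fin_cases l
    · exact ⟨x0, by simp [hblk, hx0], by rw [hzx0]; exact one_ne_zero⟩
    · exact ⟨vv (l₂ x), by simp [hblk, hvv], by rw [hzvv]; exact hl₂ x hx⟩
    · obtain ⟨k, hk⟩ := Function.ne_iff.mp (hux x hx)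
      exact ⟨uu k, by simp [hblk, huu], by rw [hzuu]; exact hk⟩
  have hTdist' : ∀ z₁ ∈ T, ∀ z₂ ∈ T, (∃ cc : Fin 3 → ℂ, z₂ = fun t => cc (blk t) * z₁ t) →
      z₂ = z₁ := by
    rintro z₁ hz₁ z₂ hz₂ ⟨cc, hcc⟩
    obtain ⟨x, hx, rfl⟩ := Finset.mem_image.mp hz₁
    obtain ⟨x₂, hx₂, rfl⟩ := Finset.mem_image.mp hz₂
    have hb0 : blk x0 = 0 := by simp [hblk, hx0]
    have hbv : ∀ i, blk (xv i) = 0 := fun i => by simp [hblk, hxv]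
    have h0 : cc 0 = 1 := by
      have h1 := congrFun hcc x0
      rw [hb0, hzx0, hzx0, mul_one] at h1
      exact h1.symm
    have hxx : x₂ = x := by
      funext i
      have h1 := congrFun hcc (xv i)
      rw [hbv, h0, one_mul, hzxv, hzxv] at h1
      exact h1
    rw [hxx]
  have hTQ' : ∀ z' ∈ T, ∀ j, eval z' (Q j) = 0 := by
    intro z' hz' j
    obtain ⟨x, hx, rfl⟩ := Finset.mem_image.mp hz'
    obtain ⟨-, -, ⟨s, t, hst⟩, hcx⟩ := (hPmem x).mp hx
    rcases j with ((_ | k) | (j | i))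
    · rw [heval_chart, hzx0]
      simp only [hzxv]
      rw [hcx, sub_self]
    · rw [heval_row, hAhat_z]
      simp only [hzvv]
      exact congrFun (hMvx x hx) k
    · rw [heval_ucut, hAhat_z]
      simp only [hzuu]
      rw [show (fun k => ux x k) = ux x from rfl, huxM x hx, zero_vecMul]
      rfl
    · rw [heval_pencil, hw_z x hx, hw_z x hx, hw_z x hx]
      exact (polarSystem_eq_zero_iff hδ).mpr ⟨s, t, hst⟩ i.1
  -- isolation: off an explicit hypersurface every solution is a lifted polar point
  have hiso' : ∀ z' ∈ T, ∃ F : MvPolynomial ((Unit ⊕ σ) ⊕ (Fin (m + 1) ⊕ Fin (m + 1))) ℂ,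
      eval z' F ≠ 0 ∧ ∀ y : (Unit ⊕ σ) ⊕ (Fin (m + 1) ⊕ Fin (m + 1)) → ℂ,
        (∀ j, eval y (Q j) = 0) → eval y F ≠ 0 →
          ∃ z'' ∈ T, ∃ cc : Fin 3 → ℂ, y = fun t => cc (blk t) * z'' t := by
    intro z' hz'
    obtain ⟨x, hx, rfl⟩ := Finset.mem_image.mp hz'
    -- the polynomial hyperplane basis `B'_v` and the reduction determinant
    set Bp : Matrix (Fin (m + 1)) (Fin m)
        (MvPolynomial ((Unit ⊕ σ) ⊕ (Fin (m + 1) ⊕ Fin (m + 1))) ℂ) :=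
      Matrix.of fun i j => if i = (l₂ x).succAbove j then X (vv (l₂ x))
        else if i = l₂ x then -X (vv ((l₂ x).succAbove j)) else 0 with hBp
    have hBp_eval : ∀ y : (Unit ⊕ σ) ⊕ (Fin (m + 1) ⊕ Fin (m + 1)) → ℂ,
        Bp.map (eval y) = Matrix.of fun i j => if i = (l₂ x).succAbove j then y (vv (l₂ x))
          else if i = l₂ x then -(y (vv ((l₂ x).succAbove j))) else 0 := by
      intro y; ext i j
      simp only [hBp, Matrix.map_apply, Matrix.of_apply]
      split_ifs <;> simp
    set GΛ : MvPolynomial ((Unit ⊕ σ) ⊕ (Fin (m + 1) ⊕ Fin (m + 1))) ℂ :=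
      ((Λᵀ).map (fun r : ℂ =>
        (C r : MvPolynomial ((Unit ⊕ σ) ⊕ (Fin (m + 1) ⊕ Fin (m + 1))) ℂ)) * Bp).det with hGΛ
    have hGΛ_eval : ∀ y : (Unit ⊕ σ) ⊕ (Fin (m + 1) ⊕ Fin (m + 1)) → ℂ, eval y GΛ =
        (Λᵀ * Matrix.of fun i j => if i = (l₂ x).succAbove j then y (vv (l₂ x))
          else if i = l₂ x then -(y (vv ((l₂ x).succAbove j))) else 0).det := by
      intro y
      rw [hGΛ, RingHom.map_det, RingHom.mapMatrix_apply, Matrix.map_mul, hBp_eval, Matrix.map_map]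
      congr 2
      ext i j; simp
    have hadj_eval : ∀ y : (Unit ⊕ σ) ⊕ (Fin (m + 1) ⊕ Fin (m + 1)) → ℂ,
        eval y (Ahat.adjugate (k₁ x) (l₁ x)) = (Ahat.map (eval y)).adjugate (k₁ x) (l₁ x) := by
      intro y
      have h := RingHom.map_adjugate (eval y) Ahat
      have h2 := congrFun (congrFun h (k₁ x)) (l₁ x)
      rw [RingHom.mapMatrix_apply, RingHom.mapMatrix_apply, Matrix.map_apply] at h2
      exact h2
    set F : MvPolynomial ((Unit ⊕ σ) ⊕ (Fin (m + 1) ⊕ Fin (m + 1))) ℂ :=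
      X x0 * X (vv (l₂ x)) * Ahat.adjugate (k₁ x) (l₁ x) * GΛ * wp (i₁ x) with hF
    have hF_eval : ∀ y : (Unit ⊕ σ) ⊕ (Fin (m + 1) ⊕ Fin (m + 1)) → ℂ, eval y F =
        y x0 * y (vv (l₂ x)) * (Ahat.map (eval y)).adjugate (k₁ x) (l₁ x) * eval y GΛ *
          eval y (wp (i₁ x)) := by
      intro y; simp only [hF, map_mul, eval_X, hadj_eval]
    refine ⟨F, ?_, fun y hyQ hyF => ?_⟩
    · rw [hF_eval, hAhat_z, hzx0, hzvv, hGΛ_eval, hw_z x hx, hadjx x hx]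
      simp only [hzvv]
      refine mul_ne_zero (mul_ne_zero (mul_ne_zero (mul_ne_zero one_ne_zero (hl₂ x hx)) ?_) ?_)
        (hi₁ x hx)
      · rw [← hadjx x hx]; exact hkl x hx
      · exact hΛdet x hx
    · rw [hF_eval] at hyF
      have hy0 : y x0 ≠ 0 := fun h => hyF (by rw [h]; ring)
      have hyv : y (vv (l₂ x)) ≠ 0 := fun h => hyF (by rw [h]; ring)
      have hyadj : (Ahat.map (eval y)).adjugate (k₁ x) (l₁ x) ≠ 0 := fun h => hyF (by rw [h]; ring)
      have hyG : eval y GΛ ≠ 0 := fun h => hyF (by rw [h]; ring)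
      have hyW : eval y (wp (i₁ x)) ≠ 0 := fun h => hyF (by rw [h]; ring)
      set x' : σ → ℂ := fun i => y (xv i) / y x0 with hx'
      set u' : Fin (m + 1) → ℂ := fun k => y (uu k) with hu'
      set v' : Fin (m + 1) → ℂ := fun l => y (vv l) with hv'
      have hscale : ∀ i, y (xv i) = y x0 * x' i := fun i => by
        rw [hx']; field_simp
      have hAy : Ahat.map (eval y) = y x0 • A.map (eval x') := hAhat_scale y x' hscale
      have hrows : A.map (eval x') *ᵥ v' = 0 := by
        have h : (Ahat.map (eval y)) *ᵥ v' = 0 := by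
          funext k
          have := hyQ (Sum.inl (Sum.inr k))
          rw [heval_row] at this
          exact this
        rw [hAy, smul_mulVec] at h
        exact (smul_eq_zero.mp h).resolve_left hy0
      have hucut : (u' ᵥ* A.map (eval x')) ᵥ* Λ = 0 := by
        have h : (u' ᵥ* Ahat.map (eval y)) ᵥ* Λ = 0 := by
          funext j
          have := hyQ (Sum.inr (Sum.inl j))
          rw [heval_ucut] at this
          exact this
        rw [hAy, vecMul_smul, smul_vecMul] at h
        exact (smul_eq_zero.mp h).resolve_left hy0
      have hchart : ∑ i, c i * x' i = 1 := by
        have h := hyQ (Sum.inl (Sum.inl ()))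
        rw [heval_chart, sub_eq_zero] at h
        have h2 : ∑ i, c i * x' i = (∑ i, c i * y (xv i)) / y x0 := by
          rw [Finset.sum_div]
          exact Finset.sum_congr rfl fun i _ => by rw [hx']; ring
        rw [h2, ← h, div_self hy0]
      have hpencil : ∀ i, i ≠ j₀ → i ≠ k₀ →
          (a j₀ * b k₀ - a k₀ * b j₀) *
              (u' ⬝ᵥ (A.map (fun p => coeff (Finsupp.single i 1) p) *ᵥ v')) -
            (b k₀ * (u' ⬝ᵥ (A.map (fun p => coeff (Finsupp.single j₀ 1) p) *ᵥ v')) -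
              b j₀ * (u' ⬝ᵥ (A.map (fun p => coeff (Finsupp.single k₀ 1) p) *ᵥ v'))) * a i -
            (a j₀ * (u' ⬝ᵥ (A.map (fun p => coeff (Finsupp.single k₀ 1) p) *ᵥ v')) -
              a k₀ * (u' ⬝ᵥ (A.map (fun p => coeff (Finsupp.single j₀ 1) p) *ᵥ v'))) * b i = 0 := by
        intro i hij hik
        have h := hyQ (Sum.inr (Sum.inr ⟨i, hij, hik⟩))
        rw [heval_pencil, heval_w, heval_w, heval_w] at h
        exact h
      have hdetΛ' : (Λᵀ * Matrix.of fun i j => if i = (l₂ x).succAbove j then v' (l₂ x)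
          else if i = l₂ x then -(v' ((l₂ x).succAbove j)) else 0).det ≠ 0 := by
        rw [hGΛ_eval] at hyG; exact hyG
      have hadj' : (A.map (eval x')).adjugate ≠ 0 := by
        intro h0
        apply hyadj
        rw [hAy, Matrix.adjugate_smul, h0, smul_zero, Matrix.zero_apply]
      have hW' : ∃ i, u' ⬝ᵥ (A.map (fun p => coeff (Finsupp.single i 1) p) *ᵥ v') ≠ 0 :=
        ⟨i₁ x, by rw [heval_w] at hyW; exact hyW⟩
      obtain ⟨hx'P, hu'M, -, -⟩ := mem_polarSet_of_kernelSystem A hA1 a b c hδ Λ x' u' v'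
        hchart hrows hucut hpencil hyv hdetΛ' hadj' hW'
      have hx'P' : x' ∈ P := (hPmem x').mpr hx'P
      have hdet' : (A.map (eval x')).det = 0 := by rw [det_map_eval]; exact hx'P.1
      obtain ⟨α, hα⟩ := exists_smul_of_vecMul_eq_zero hdet' hadj' (hux x' hx'P') (huxM x' hx'P')
        u' hu'M
      obtain ⟨β, hβ⟩ := exists_smul_of_mulVec_eq_zero hdet' hadj' (hvx x' hx'P') (hMvx x' hx'P')
        v' hrows
      refine ⟨z x', Finset.mem_image_of_mem z hx'P', ![y x0, β, α], ?_⟩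
      funext t
      rcases t with ((_ | i) | (k | l))
      · rw [← hx0, hzx0, mul_one]
        simp [hblk, hx0]
      · change y (xv i) = _
        rw [hscale i, hzxv]
        simp [hblk]
      · change u' k = _
        rw [hα, hzuu]
        simp [hblk]
      · change v' l = _
        rw [hβ, hzvv]
        simp [hblk]
  -- ### the refined Bézout count and the mixed Bézout number
  have key := card_le_mixedBezout_of_isolated_fintype blk hblk' hr' Q δ hQ' hQ0' T hT' hTdist'
    hTQ' hiso'
  rw [hT, Finset.card_image_of_injective P hzinj] at key
  rw [Set.ncard_eq_toFinset_card _ hfin, ← hP]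
  refine key.trans (le_of_eq ?_)
  have hc : ∀ l : Fin 3, ((univ : Finset ((Unit ⊕ σ) ⊕ (Fin (m + 1) ⊕ Fin (m + 1)))).filter
      (fun t => blk t = l)).card = ![Fintype.card σ + 1, m + 1, m + 1] l := by
    intro l
    rw [Finset.card_filter, Fintype.sum_sum_type, Fintype.sum_sum_type, Fintype.sum_sum_type]
    fin_cases l
    · simp [hblk]; omega
    · simp [hblk]
    · simp [hblk]
  have hexp : (Finsupp.equivFunOnFinite.symm fun l : Fin 3 =>
      ((univ : Finset ((Unit ⊕ σ) ⊕ (Fin (m + 1) ⊕ Fin (m + 1)))).filter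
        (fun t => blk t = l)).card - 1) =
      Finsupp.single 0 (Fintype.card σ) + Finsupp.single 1 (m + 1 - 1) +
        Finsupp.single 2 (m + 1 - 1) := by
    ext l
    simp only [Finsupp.coe_equivFunOnFinite_symm, hc, Finsupp.add_apply,
      Finsupp.single_apply]
    fin_cases l <;> simp
  have hprod : (∏ j, ∑ l, δ j l • (X l : MvPolynomial (Fin 3) ℕ)) =
      X 0 * (X 0 + X 1) ^ (m + 1) * (X 0 + X 2) ^ (m + 1 - 1) *
        (X 1 + X 2) ^ (Fintype.card σ - 2) := by
    rw [Fintype.prod_sum_type, Fintype.prod_sum_type, Fintype.prod_sum_type]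
    simp only [hδdef, Sum.elim_inl, Sum.elim_inr, Finset.prod_const, Finset.card_univ,
      Fintype.card_fin, Fintype.card_unit, hcardS, Fin.sum_univ_three, Pi.add_apply,
      Pi.single_apply]
    simp
    ring
  rw [hexp, hprod, coeff_generatingFunction_eq_conormalBezout (m + 1) (Fintype.card σ) (by omega)
    (by omega)]

end DeterminantalConormal

/-! ## The discharge of `Sheshadri2026_polarCount_le` -/

open DeterminantalConormal in
/-- **Sheshadri's polar-count bound `#T_f(a,b,c) ≤ B(m, N)`** (arXiv:2606.13628, §1 eq. (1.1),
Lemmas 4–5): if a form `f` in `N ≥ 3` variables has an affine `m × m` determinantal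
representation, then for `(a, b, c)` off the zero set of a non-zero polynomial `Φ` the polar set
`T_f(a, b, c) = {f = 0, ∇f ≠ 0, ∇f ∈ span(a,b), c·x = 1}` has at most
`B(m, N) = Σ_i C(m,i) C(m-1,N-1-i) C(N-2,i-1)` points (counted with `Set.ncard`).
Small cases (`N = 3`, `deg f ≤ 2`, `m ≤ 2`) are `Sheshadri2026_polarCount_le_of_small_cases`;
in the main case `Φ = δ₀ · Π_{i ∉ {j₀,k₀}} χ_i` only enforces `a ∦ b` and the non-triviality of
the pencil equations, an infinite polar set has `ncard = 0`, and a finite one is bounded by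
`ncard_polarSet_le_conormalBezout_of_pencil` (multigraded refined Bézout count of the
kernel-incidence system). [cite: Sheshadri2026Border, eq. (1.1), Lemmas 4–5, §3.1] -/
theorem Sheshadri2026_polarCount_le_holds : Sheshadri2026_polarCount_le := by
  intro σ _ _ hσ f d m hf hm
  classical
  by_cases hsmall : Fintype.card σ = 3 ∨ f.totalDegree ≤ 2 ∨ m ≤ 2 ∨ 2 * m < Fintype.card σ
  · exact Sheshadri2026_polarCount_le_of_small_cases hσ f d m hsmall hf hm
  push Not at hsmall
  obtain ⟨-, hdeg2, hm2, -⟩ := hsmall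
  obtain ⟨A, hA1, hAf⟩ := hm
  obtain ⟨m', rfl⟩ : ∃ m', m = m' + 1 := ⟨m - 1, by omega⟩
  -- some linear coefficient of some entry is non-zero (else `f = det A` would be a constant)
  have hcoef : ∃ j₀ k l, coeff (Finsupp.single j₀ 1) (A k l) ≠ 0 := by
    by_contra h
    push Not at h
    have hconst : ∀ k l, A k l = C (coeff 0 (A k l)) := fun k l => by
      conv_lhs => rw [eq_C_add_sum_of_totalDegree_le_one (hA1 k l)]
      simp [h]
    have hA : A = (A.map (coeff 0)).map (C : ℂ →+* MvPolynomial σ ℂ) := by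
      refine Matrix.ext fun k l => ?_
      rw [Matrix.map_apply, Matrix.map_apply]
      exact hconst k l
    have hdetC : A.det = C ((A.map (coeff 0)).det) := by
      conv_lhs => rw [hA]
      rw [← RingHom.mapMatrix_apply, ← RingHom.map_det]
    have h0 : f.totalDegree = 0 := by rw [← hAf, hdetC, totalDegree_C]
    omega
  obtain ⟨j₀, ks, ls, hjs⟩ := hcoef
  haveI : Nontrivial σ := Fintype.one_lt_card_iff_nontrivial.mp (by omega)
  obtain ⟨k₀, hk₀⟩ := exists_ne j₀
  -- ### the genericity polynomial `Φ = δ₀ · Π χ_i`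
  set cf : σ → ℂ := fun i => coeff (Finsupp.single i 1) (A ks ls) with hcf
  set δp : MvPolynomial (Fin 3 × σ) ℂ := X (0, j₀) * X (1, k₀) - X (0, k₀) * X (1, j₀) with hδp
  set χ : σ → MvPolynomial (Fin 3 × σ) ℂ := fun i => δp * C (cf i) -
    (X (1, k₀) * C (cf j₀) - X (1, j₀) * C (cf k₀)) * X (0, i) -
    (X (0, j₀) * C (cf k₀) - X (0, k₀) * C (cf j₀)) * X (1, i) with hχ
  have hδp_eval : ∀ u : Fin 3 × σ → ℂ,
      eval u δp = u (0, j₀) * u (1, k₀) - u (0, k₀) * u (1, j₀) := by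
    intro u; simp [hδp]
  have hχ_eval : ∀ (u : Fin 3 × σ → ℂ) i, eval u (χ i) =
      (u (0, j₀) * u (1, k₀) - u (0, k₀) * u (1, j₀)) * cf i -
        (u (1, k₀) * cf j₀ - u (1, j₀) * cf k₀) * u (0, i) -
        (u (0, j₀) * cf k₀ - u (0, k₀) * cf j₀) * u (1, i) := by
    intro u i; simp [hχ, hδp]
  refine ⟨δp * ∏ i ∈ univ.filter (fun i => i ≠ j₀ ∧ i ≠ k₀), χ i, ?_, fun u hu => ?_⟩
  · refine mul_ne_zero ?_ (Finset.prod_ne_zero_iff.mpr fun i hi => ?_)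
    · intro h
      have h1 := congrArg (eval (fun p : Fin 3 × σ =>
        if p = (0, j₀) ∨ p = (1, k₀) then (1 : ℂ) else 0)) h
      rw [hδp_eval, map_zero] at h1
      simp [hk₀] at h1
    · obtain ⟨hij, hik⟩ := (Finset.mem_filter.mp hi).2
      intro h
      have h1 := congrArg (eval (fun p : Fin 3 × σ =>
        if p = (0, i) ∨ p = (1, k₀) then (1 : ℂ) else 0)) h
      rw [hχ_eval, map_zero] at h1
      simp [hk₀.symm, hik, Ne.symm hij, Ne.symm hik, hcf, hjs] at h1
  · rw [map_mul, map_prod] at hu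
    have hδ : u (0, j₀) * u (1, k₀) - u (0, k₀) * u (1, j₀) ≠ 0 := by
      rw [← hδp_eval]; exact left_ne_zero_of_mul hu
    have hprod := right_ne_zero_of_mul hu
    rw [Finset.prod_ne_zero_iff] at hprod
    rcases Set.finite_or_infinite
      (polarSet f (fun i => u (0, i)) (fun i => u (1, i)) fun i => u (2, i)) with hfin | hinf
    · have hf0 : A.det ≠ 0 := by
        rw [hAf]; rintro rfl; simp at hdeg2
      rw [← hAf] at hfin ⊢
      refine ncard_polarSet_le_conormalBezout_of_pencil hσ A hA1 hf0 _ _ _ hk₀.symm hδ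
        (fun i hij hik => ⟨ks, ls, ?_⟩) hfin
      have h := hprod i (Finset.mem_filter.mpr ⟨Finset.mem_univ _, hij, hik⟩)
      rw [hχ_eval] at h
      exact h
    · rw [hinf.ncard]; exact Nat.zero_le _

end Literature.Computability.AlgebraicComplexity

end
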